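import Summits.Ventures.Crystal3D.StickySpheres.RadiusOne
import Literature.Geometry.DiscreteGeometry.TruncatedDodecahedralBound
import Mathlib.Geometry.Euclidean.PerpBisector
import Mathlib.MeasureTheory.Measure.Lebesgue.EqHaar
import Mathlib.MeasureTheory.Measure.Haar.InnerProductSpace
import HarnessLib

/-!
# Volume of the union of probing balls from the truncated dodecahedral bound

HONEST FRAMING. Part of the venture `Summits/Ventures/Crystal3D` (cell `pub-crystal3d`), a step of
discharging the isoperimetric input `(I)` of headline H2 from Literature named facts. Under the
tree's named fact `HalesDSP_truncatedDodecahedral` (Hales–McLaughlin / Hales DSP: every Voronoi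
cell of a unit-ball packing, truncated at radius `√2`, has volume at least that of the regular
dodecahedron; NOT proved in the tree) this file PROVES: for a packing `x` of `N` diameter-`1`
balls and any `R ≥ √2`, the union of the balls `B̄(2xᵢ, R)` (radius-`1` picture) has volume
`≥ N · (4π/3)/0.7547`. Argument: the truncated Voronoi cells of the doubled centres lie in the
`√2`-balls, have volume `> (4π/3)/0.7547` each (`volume_truncatedVoronoiCell_gt_of`), and are
pairwise almost disjoint (their pairwise intersections lie in perpendicular-bisector planes, which
are Lebesgue-null). Nothing else is claimed.
-/

noncomputable section

open scoped BigOperators ENNReal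
open Finset Real MeasureTheory Set Metric Function

namespace Summit.Ventures.Crystal3D

open Literature.Geometry.DiscreteGeometry (IsUnitBallPacking HalesDSP_truncatedDodecahedral
  volume_truncatedVoronoiCell_gt_of)
open Literature.Barriers.AtomisticToContinuum (voronoiCell)

variable {N : ℕ} {x : Fin N → EuclideanSpace ℝ (Fin 3)}

/-- The Voronoi cell of a point of a set is closed. -/
theorem isClosed_voronoiCell (V : Set (EuclideanSpace ℝ (Fin 3))) (v : EuclideanSpace ℝ (Fin 3)) :
    IsClosed (voronoiCell V v) := by
  have : voronoiCell V v = ⋂ w ∈ V, {p | dist p v ≤ dist p w} := by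
    ext p; simp [voronoiCell, mem_iInter]
  rw [this]
  exact isClosed_biInter fun w _ =>
    isClosed_le (continuous_id.dist continuous_const) (continuous_id.dist continuous_const)

/-- Two Voronoi cells of distinct sites meet inside the perpendicular bisector (a null plane). -/
theorem voronoiCell_inter_subset_perpBisector {V : Set (EuclideanSpace ℝ (Fin 3))}
    {v w : EuclideanSpace ℝ (Fin 3)} (hv : v ∈ V) (hw : w ∈ V) :
    voronoiCell V v ∩ voronoiCell V w ⊆ (AffineSubspace.perpBisector v w : Set _) := by
  rintro p ⟨hpv, hpw⟩
  rw [SetLike.mem_coe, AffineSubspace.mem_perpBisector_iff_dist_eq]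
  exact le_antisymm (hpv w hw) (hpw v hv)

/-- **Union volume from the dodecahedral bound.** Under `HalesDSP_truncatedDodecahedral`, for a
packing `x` of `N` diameter-`1` balls and `R ≥ √2`, the union of the radius-`R` balls about the
doubled centres has volume at least `N · (4π/3)/0.7547`. -/
theorem volume_iUnion_closedBall_ge_dodeca (h : HalesDSP_truncatedDodecahedral)
    (hx : IsUnitPacking x) {R : ℝ} (hR : Real.sqrt 2 ≤ R) :
    ENNReal.ofReal ((N : ℝ) * ((4 * π / 3) / 0.7547)) ≤
      volume (⋃ i, closedBall ((2 : ℝ) • x i) R) := by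
  classical
  set y : Fin N → EuclideanSpace ℝ (Fin 3) := fun i => (2 : ℝ) • x i with hy
  obtain ⟨hinj, hV⟩ := (isUnitPacking_iff_two_smul x).1 hx
  set V : Set (EuclideanSpace ℝ (Fin 3)) := Set.range y with hVdef
  set cell : Fin N → Set (EuclideanSpace ℝ (Fin 3)) :=
    fun i => voronoiCell V (y i) ∩ closedBall (y i) (Real.sqrt 2) with hcell
  -- each cell is big
  have hbig : ∀ i, ENNReal.ofReal ((4 * π / 3) / 0.7547) ≤ volume (cell i) :=
    fun i => (volume_truncatedVoronoiCell_gt_of h hV (Set.mem_range_self i)).le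
  -- cells are measurable and pairwise a.e. disjoint
  have hmeas : ∀ i ∈ (univ : Finset (Fin N)), NullMeasurableSet (cell i) volume := fun i _ =>
    ((isClosed_voronoiCell V (y i)).inter isClosed_closedBall).measurableSet.nullMeasurableSet
  have hdisj : (↑(univ : Finset (Fin N)) : Set (Fin N)).Pairwise (AEDisjoint volume on cell) := by
    intro i _ j _ hij
    have hne : y i ≠ y j := fun e => hij (hinj e)
    have hsub : cell i ∩ cell j ⊆ (AffineSubspace.perpBisector (y i) (y j) : Set _) :=
      fun p hp => voronoiCell_inter_subset_perpBisector (V := V) (v := y i) (w := y j)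
        (Set.mem_range_self i) (Set.mem_range_self j) ⟨hp.1.1, hp.2.1⟩
    have hnull : volume ((AffineSubspace.perpBisector (y i) (y j) : Set (EuclideanSpace ℝ (Fin 3))))
        = 0 :=
      Measure.addHaar_affineSubspace volume _
        (fun htop => hne ((AffineSubspace.perpBisector_eq_top).1 htop))
    exact measure_mono_null hsub hnull
  -- cells lie in the union of the `R`-balls
  have hsubU : (⋃ i ∈ (univ : Finset (Fin N)), cell i) ⊆ ⋃ i, closedBall (y i) R := by
    intro p hp
    obtain ⟨i, -, hpi⟩ := mem_iUnion₂.1 hp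
    exact mem_iUnion.2 ⟨i, closedBall_subset_closedBall hR hpi.2⟩
  calc ENNReal.ofReal ((N : ℝ) * ((4 * π / 3) / 0.7547))
      = ∑ _i : Fin N, ENNReal.ofReal ((4 * π / 3) / 0.7547) := by
        rw [sum_const, card_univ, Fintype.card_fin, nsmul_eq_mul,
          ENNReal.ofReal_mul (Nat.cast_nonneg N), ENNReal.ofReal_natCast]
    _ ≤ ∑ i, volume (cell i) := sum_le_sum fun i _ => hbig i
    _ = volume (⋃ i ∈ (univ : Finset (Fin N)), cell i) := (measure_biUnion_finset₀ hdisj hmeas).symm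
    _ ≤ volume (⋃ i, closedBall (y i) R) := measure_mono hsubU

end Summit.Ventures.Crystal3D

end
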